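import Mathlib
import Summits.KontsevichZagierPeriods.KontsevichZagierPeriods.Theorems.HeckeMultiplicityOneManinStokesJacobianLocal
import Summits.KontsevichZagierPeriods.KontsevichZagierPeriods.Theorems.HeckeMultiplicityOneManinStokesJacobianCusp
import Summits.KontsevichZagierPeriods.KontsevichZagierPeriods.Theorems.HeckeMultiplicityOneManinStokesTileInverse
import Literature.Analysis.Complex.LengthArea

/-!
# `ManinStokes` (stmt-KontsevichZagierPeriods-5277): integrability of `G′` on the lower half plane (`u = j(z)`)

Support file (prover-owned, `--supports stmt-KontsevichZagierPeriods-5277`). The hypothesis `hGint` of the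
three-edge Cauchy relation (`…HalfPlaneCauchy.lean`) for `G = (ω/dj) ∘ ψ`: `G'` is absolutely integrable on the
open lower half plane. By Mathlib's Jacobian formula (`integrableOn_image_iff_integrableOn_abs_det_fderiv_smul`)
for the injective holomorphic map `j` of the open tile `τ₀ = {0 < re z < 1/2, |z| > 1}` onto `{im u < 0}`
this is integrability of `‖J'‖² G'(j z) = ‖J'‖² F'/J'` on `τ₀`, of norm `‖J'‖‖F'‖`, which is `≤ C/|z − z₀|`
near every point of the compact part `[0,1/2] × [1/2,3]` (`…JacobianLocal.lean`, finite subcover) and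
`≤ C e^{−2π im z/h}` on the half strip `im > 3` (`…JacobianCusp.lean`).

References: M. Kontsevich, D. Zagier, *Periods* (2001), §1.2, §3.4. No definitions, no named facts.
-/

noncomputable section

open scoped MatrixGroups ModularForm Modular Manifold Topology
open CongruenceSubgroup Complex Set Filter MeasureTheory ModularForm
open UpperHalfPlane hiding I
open Literature.NumberTheory.EllipticCurves Literature.NumberTheory.EllipticCurves.ModularForms

namespace Summit.KontsevichZagierPeriods.HeckeMultiplicityOne.ManinStokes

/-! ## Integrability of `G'` on the lower half plane (change of variables `u = j(z)`)

`∬_{im u < 0} |G'(u)| = ∬_{τ₀} |G'(j z)| |j'(z)|² = ∬_{τ₀} |F'(z)| |j'(z)|` (`G ∘ j = F` on the open tile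
`τ₀ = {0 < re z < 1/2, |z| > 1}`, `j` injective there with image the open lower half plane); the last
integrand is `≤ C/|z − z₀|` near every point of the compact part `im ≤ 3` of the closed tile and
`≤ C e^{−2π im z/h}` on the cusp part. -/

section Jacobian

open Metric

/-- The open tile `τ₀` as a subset of `ℂ` is open. [folklore] -/
theorem isOpen_tileC :
    IsOpen {z : ℂ | 0 < z.im ∧ 0 < z.re ∧ z.re < 1 / 2 ∧ 1 < Complex.normSq z} :=
  (isOpen_lt continuous_const Complex.continuous_im).inter
    ((isOpen_lt continuous_const Complex.continuous_re).inter
      ((isOpen_lt Complex.continuous_re continuous_const).inter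
        (isOpen_lt continuous_const Complex.continuous_normSq)))

/-- A point of the open tile, as a point of `ℍ`, lies in the closed half fundamental domain. [folklore] -/
theorem mk_mem_halfFd_of_mem_tileC {z : ℂ}
    (hz : z ∈ {z : ℂ | 0 < z.im ∧ 0 < z.re ∧ z.re < 1 / 2 ∧ 1 < Complex.normSq z}) :
    (⟨z, hz.1⟩ : ℍ) ∈ {z : ℍ | z ∈ 𝒟 ∧ 0 ≤ z.re} :=
  ⟨⟨hz.2.2.2.le, abs_le.mpr ⟨by show -(1 / 2 : ℝ) ≤ z.re; linarith [hz.2.1], hz.2.2.1.le⟩⟩, hz.2.1.le⟩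

/-- `im j(z) < 0` on the open tile. [folklore] -/
theorem kleinJ_ofComplex_im_neg {z : ℂ}
    (hz : z ∈ {z : ℂ | 0 < z.im ∧ 0 < z.re ∧ z.re < 1 / 2 ∧ 1 < Complex.normSq z}) :
    ((kleinJ ∘ ofComplex) z).im < 0 := by
  rw [Function.comp_apply, ofComplex_apply_of_im_pos hz.1]
  exact kleinJ_im_neg_of_mem_tile (z := ⟨z, hz.1⟩) ⟨hz.2.1, hz.2.2.1, hz.2.2.2⟩

/-- **`j` maps the open tile onto the open lower half plane.** [folklore] -/
theorem image_kleinJ_tileC :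
    (kleinJ ∘ ofComplex) '' {z : ℂ | 0 < z.im ∧ 0 < z.re ∧ z.re < 1 / 2 ∧ 1 < Complex.normSq z} =
      {u : ℂ | u.im < 0} := by
  ext u
  constructor
  · rintro ⟨z, hz, rfl⟩
    exact kleinJ_ofComplex_im_neg hz
  · intro hu
    obtain ⟨τ, hτ, hj⟩ := exists_mem_tile_kleinJ_eq hu
    refine ⟨(τ : ℂ), ⟨τ.im_pos, hτ.1, hτ.2.1, hτ.2.2⟩, ?_⟩
    rw [Function.comp_apply, ofComplex_apply]
    exact hj

/-- **`j` is injective on the open tile.** [folklore] -/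
theorem injOn_kleinJ_tileC :
    InjOn (kleinJ ∘ ofComplex) {z : ℂ | 0 < z.im ∧ 0 < z.re ∧ z.re < 1 / 2 ∧ 1 < Complex.normSq z} := by
  intro z₁ h₁ z₂ h₂ heq
  have heq' : kleinJ (⟨z₁, h₁.1⟩ : ℍ) = kleinJ (⟨z₂, h₂.1⟩ : ℍ) := by
    simpa [Function.comp_apply, ofComplex_apply_of_im_pos h₁.1, ofComplex_apply_of_im_pos h₂.1] using heq
  have e := kleinJ_injOn_halfFd (mk_mem_halfFd_of_mem_tileC h₁) (mk_mem_halfFd_of_mem_tileC h₂) heq'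
  exact congrArg UpperHalfPlane.coe e

/-- `J' ≠ 0` on the open tile. [folklore] -/
theorem deriv_kleinJ_ne_zero_of_mem_tileC {z : ℂ}
    (hz : z ∈ {z : ℂ | 0 < z.im ∧ 0 < z.re ∧ z.re < 1 / 2 ∧ 1 < Complex.normSq z}) :
    deriv (kleinJ ∘ ofComplex) z ≠ 0 := by
  have h := kleinJ_ofComplex_im_neg hz
  rw [Function.comp_apply, ofComplex_apply_of_im_pos hz.1] at h
  exact deriv_kleinJ_ne_zero_of_im_ne_zero (z := ⟨z, hz.1⟩) h.ne

variable {h : ℝ} {φ : ℍ → ℂ} {ψ : ℂ → ℍ}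

/-- **`G' ∘ j = F'/J'` on the open tile** (`G = (ω/dj) ∘ ψ`, `ψ ∘ j = id` on the tile, chain rule). [folklore] -/
theorem deriv_djQuot_tileInv_kleinJ
    (hψ : ∀ u : ℂ, u.im ≤ 0 → ψ u ∈ {z : ℍ | z ∈ 𝒟 ∧ 0 ≤ z.re} ∧ kleinJ (ψ u) = u)
    (hφ : MDifferentiable 𝓘(ℂ) 𝓘(ℂ) φ) {z : ℂ}
    (hz : z ∈ {z : ℂ | 0 < z.im ∧ 0 < z.re ∧ z.re < 1 / 2 ∧ 1 < Complex.normSq z}) :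
    deriv (fun u => djQuot φ (ψ u)) ((kleinJ ∘ ofComplex) z) =
      deriv (djQuot φ ∘ ofComplex) z * (deriv (kleinJ ∘ ofComplex) z)⁻¹ := by
  have hu := kleinJ_ofComplex_im_neg hz
  rw [Function.comp_apply, ofComplex_apply_of_im_pos hz.1] at hu ⊢
  have hψτ : ψ (kleinJ (⟨z, hz.1⟩ : ℍ)) = ⟨z, hz.1⟩ := tileInv_kleinJ hψ (mk_mem_halfFd_of_mem_tileC hz)
  have hd := hasDerivAt_djQuot_tileInv hψ hφ hu
  rw [hψτ] at hd
  exact hd.deriv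

/-- `F'` is continuous on the open tile (indeed holomorphic on `{im > 0, J' ≠ 0}`). [folklore] -/
theorem continuousOn_deriv_djQuot_tileC (hφ : MDifferentiable 𝓘(ℂ) 𝓘(ℂ) φ) :
    ContinuousOn (deriv (djQuot φ ∘ ofComplex))
      {z : ℂ | 0 < z.im ∧ 0 < z.re ∧ z.re < 1 / 2 ∧ 1 < Complex.normSq z} := by
  set W := {z : ℂ | 0 < z.im} ∩ deriv (kleinJ ∘ ofComplex) ⁻¹' {0}ᶜ with hW
  have hWo : IsOpen W := analyticOnNhd_deriv_kleinJ.continuousOn.isOpen_inter_preimage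
    (isOpen_lt continuous_const Complex.continuous_im) isOpen_compl_singleton
  have hFd : DifferentiableOn ℂ (djQuot φ ∘ ofComplex) W := fun w hw =>
    (differentiableAt_djQuot_of_deriv_kleinJ_ne_zero hφ hw.1 hw.2).differentiableWithinAt
  exact (hFd.analyticOnNhd hWo).deriv.continuousOn.mono fun z hz =>
    ⟨hz.1, deriv_kleinJ_ne_zero_of_mem_tileC hz⟩

/-- The real Jacobian determinant of multiplication by `c` on `ℂ` is `‖c‖²`. [folklore] -/
theorem abs_det_restrictScalars_smulRight (c : ℂ) :
    |((ContinuousLinearMap.smulRight (1 : ℂ →L[ℂ] ℂ) c).restrictScalars ℝ).det| = ‖c‖ ^ 2 := by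
  rw [Literature.Analysis.Complex.LengthArea.det_restrictScalars_smulRight, abs_of_nonneg (sq_nonneg _)]

/-- `z ↦ 1/|z − x|` is integrable on every disc about `x` in `ℂ = ℝ²`. [folklore] -/
theorem integrableOn_norm_sub_inv (x : ℂ) (r : ℝ) : IntegrableOn (fun z : ℂ => ‖z - x‖⁻¹) (ball x r) := by
  have h1 : IntegrableOn (fun z : ℂ => ‖z‖⁻¹) (ball 0 r) := by
    refine integrableOn_ball_of_norm_le_rpow (by rw [Complex.finrank_real_complex]; norm_num)
      (C := 1) (α := 1) (by rw [Complex.finrank_real_complex]; norm_num) (Eventually.of_forall fun z => ?_)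
      (measurable_norm.inv.aestronglyMeasurable)
    rw [norm_inv, norm_norm, Real.rpow_neg_one, one_mul]
  have hmp := measurePreserving_sub_right (volume : Measure ℂ) x
  have h2 := (hmp.integrableOn_comp_preimage (MeasurableEquiv.subRight x).measurableEmbedding).mpr h1
  have hpre : (fun z : ℂ => z - x) ⁻¹' ball (0 : ℂ) r = ball x r := by
    ext z; simp [dist_eq_norm]
  rw [hpre] at h2
  exact h2

/-- `z ↦ e^{−c im z}` (`c > 0`) is integrable on the half strip `{0 < re < 1/2, 3 < im}`. [folklore] -/
theorem integrableOn_exp_neg_mul_im {c : ℝ} (hc : 0 < c) :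
    IntegrableOn (fun z : ℂ => Real.exp (-c * z.im)) {z : ℂ | 0 < z.re ∧ z.re < 1 / 2 ∧ 3 < z.im} := by
  have hA : Integrable (fun _ : ℝ => (1 : ℝ)) (volume.restrict (Ioo (0 : ℝ) (1 / 2))) :=
    integrableOn_const (by rw [Real.volume_Ioo]; exact ENNReal.ofReal_ne_top)
  have hB : Integrable (fun t : ℝ => Real.exp (-c * t)) (volume.restrict (Ioi (3 : ℝ))) :=
    exp_neg_integrableOn_Ioi 3 hc
  have hprod := hA.mul_prod hB
  rw [Measure.prod_restrict] at hprod
  have hprod' : IntegrableOn (fun p : ℝ × ℝ => Real.exp (-c * p.2)) (Ioo (0 : ℝ) (1 / 2) ×ˢ Ioi (3 : ℝ))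
      (volume : Measure (ℝ × ℝ)) := by
    rw [IntegrableOn, Measure.volume_eq_prod]
    simpa only [one_mul] using hprod
  have h2 := (Complex.volume_preserving_equiv_real_prod.integrableOn_comp_preimage
    Complex.measurableEquivRealProd.measurableEmbedding).mpr hprod'
  have hpre : Complex.measurableEquivRealProd ⁻¹' (Ioo (0 : ℝ) (1 / 2) ×ˢ Ioi (3 : ℝ)) =
      {z : ℂ | 0 < z.re ∧ z.re < 1 / 2 ∧ 3 < z.im} := by
    ext z
    simp [Complex.measurableEquivRealProd_apply, and_assoc]
  rw [hpre] at h2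
  exact h2

/-- **Integrability of the Jacobian integrand on the open tile**: the function
`z ↦ ‖J'(z)‖² · F'(z)/J'(z)` (norm `‖J'‖‖F'‖`) is integrable on `τ₀` for every cusp function `φ`.
[folklore] -/
theorem integrableOn_jacobian_tileC (hφ : IsCuspFunction h φ) :
    IntegrableOn (fun z : ℂ => (‖deriv (kleinJ ∘ ofComplex) z‖ ^ 2 : ℝ) •
        (deriv (djQuot φ ∘ ofComplex) z * (deriv (kleinJ ∘ ofComplex) z)⁻¹))
      {z : ℂ | 0 < z.im ∧ 0 < z.re ∧ z.re < 1 / 2 ∧ 1 < Complex.normSq z} := by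
  set T := {z : ℂ | 0 < z.im ∧ 0 < z.re ∧ z.re < 1 / 2 ∧ 1 < Complex.normSq z} with hT
  set J' := deriv (kleinJ ∘ ofComplex) with hJ'
  set F' := deriv (djQuot φ ∘ ofComplex) with hF'
  set Ψ : ℂ → ℂ := fun z => (‖J' z‖ ^ 2 : ℝ) • (F' z * (J' z)⁻¹) with hΨ
  have hTm : MeasurableSet T := isOpen_tileC.measurableSet
  -- continuity and norm of `Ψ` on `T`
  have hJc : ContinuousOn J' T := analyticOnNhd_deriv_kleinJ.continuousOn.mono fun z hz => hz.1
  have hΨc : ContinuousOn Ψ T :=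
    ((hJc.norm.pow 2).smul ((continuousOn_deriv_djQuot_tileC hφ.mdifferentiable).mul
      (hJc.inv₀ fun z hz => deriv_kleinJ_ne_zero_of_mem_tileC hz)))
  have hΨn : ∀ z ∈ T, ‖Ψ z‖ = ‖J' z‖ * ‖F' z‖ := by
    intro z hz
    have hne : ‖J' z‖ ≠ 0 := norm_ne_zero_iff.mpr (deriv_kleinJ_ne_zero_of_mem_tileC hz)
    simp only [hΨ, norm_smul, norm_pow, Real.norm_eq_abs, abs_norm, norm_mul, norm_inv]
    field_simp
  have hunion : T = (T ∩ {z | z.im ≤ 3}) ∪ (T ∩ {z | 3 < z.im}) := by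
    ext z
    simp only [mem_union, mem_inter_iff, mem_setOf_eq]
    constructor
    · intro hz
      rcases le_or_gt z.im 3 with h3 | h3
      · exact Or.inl ⟨hz, h3⟩
      · exact Or.inr ⟨hz, h3⟩
    · rintro (⟨hz, -⟩ | ⟨hz, -⟩) <;> exact hz
  rw [hunion]
  refine IntegrableOn.union ?_ ?_
  · -- the compact part: finite subcover by the balls of `exists_ball_norm_deriv_mul_le`
    set K := (Icc (0 : ℝ) (1 / 2)) ×ℂ (Icc (1 / 2 : ℝ) 3) with hK
    have hKc : IsCompact K := isCompact_Icc.reProdIm isCompact_Icc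
    have hsub : T ∩ {z | z.im ≤ 3} ⊆ K := by
      rintro z ⟨hz, hz3⟩
      have h1 : 1 < z.re * z.re + z.im * z.im := by
        have := hz.2.2.2; rwa [Complex.normSq_apply] at this
      refine Complex.mem_reProdIm.mpr ⟨⟨hz.2.1.le, hz.2.2.1.le⟩, ?_, hz3⟩
      nlinarith [hz.1, hz.2.1, hz.2.2.1]
    have H : ∀ x ∈ K, ∃ r > 0, ∃ C, ∀ z ∈ ball x r, z ≠ x → ‖J' z‖ * ‖F' z‖ ≤ C * ‖z - x‖⁻¹ :=
      fun x hx => exists_ball_norm_deriv_mul_le hφ.mdifferentiable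
        (by have := (Complex.mem_reProdIm.mp hx).2.1; linarith)
    choose! r hr C hC using H
    obtain ⟨t, htK, hcover⟩ := hKc.elim_nhds_subcover (fun x => ball x (r x))
      (fun x hx => ball_mem_nhds x (hr x hx))
    have hsub2 : T ∩ {z | z.im ≤ 3} ⊆ ⋃ x ∈ t, (ball x (r x) ∩ T) := by
      intro z hz
      have hz' := hcover (hsub hz)
      simp only [mem_iUnion] at hz' ⊢
      obtain ⟨x, hxt, hzx⟩ := hz'
      exact ⟨x, hxt, hzx, hz.1⟩
    refine IntegrableOn.mono_set ?_ hsub2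
    refine integrableOn_finset_iUnion.mpr fun x hx => ?_
    have hxK := htK x hx
    have hm : MeasurableSet (ball x (r x) ∩ T) := measurableSet_ball.inter hTm
    refine Integrable.mono' (g := fun z => C x * ‖z - x‖⁻¹) ?_
      ((hΨc.mono inter_subset_right).aestronglyMeasurable hm) ?_
    · exact ((integrableOn_norm_sub_inv x (r x)).mono_set inter_subset_left).const_mul (C x)
    · have hne : ∀ᵐ z ∂(volume.restrict (ball x (r x) ∩ T)), z ≠ x := by
        refine ae_restrict_of_ae ?_
        have h0 : volume ({x} : Set ℂ) = 0 := measure_singleton x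
        exact measure_eq_zero_iff_ae_notMem.mp h0
      filter_upwards [hne, ae_restrict_mem hm] with z hz hzm
      rw [hΨn z hzm.2]
      exact hC x hxK z hzm.1 hz
  · -- the cusp part
    obtain ⟨Cc, hCc⟩ := exists_norm_deriv_mul_le_cusp hφ
    have hc : 0 < 2 * Real.pi / h := by have := hφ.pos; positivity
    have hm : MeasurableSet (T ∩ {z | 3 < z.im}) := hTm.inter (measurableSet_lt measurable_const measurable_im)
    refine Integrable.mono' (g := fun z => Cc * Real.exp (-(2 * Real.pi / h) * z.im)) ?_
      ((hΨc.mono inter_subset_left).aestronglyMeasurable hm) ?_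
    · refine ((integrableOn_exp_neg_mul_im hc).mono_set ?_).const_mul Cc
      rintro z ⟨hz, hz3⟩
      exact ⟨hz.2.1, hz.2.2.1, hz3⟩
    · filter_upwards [ae_restrict_mem hm] with z hzm
      rw [hΨn z hzm.1]
      exact hCc z hzm.2.le

/-- **`∬_{im u < 0} |G'(u)| < ∞`** for `G = (ω/dj) ∘ ψ`: the change of variables `u = j(z)` from the
open tile (Mathlib's `integrableOn_image_iff_integrableOn_abs_det_fderiv_smul`). [folklore] -/
theorem integrableOn_deriv_djQuot_tileInv_complex
    (hψ : ∀ u : ℂ, u.im ≤ 0 → ψ u ∈ {z : ℍ | z ∈ 𝒟 ∧ 0 ≤ z.re} ∧ kleinJ (ψ u) = u)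
    (hφ : IsCuspFunction h φ) :
    IntegrableOn (deriv fun u => djQuot φ (ψ u)) {u : ℂ | u.im < 0} := by
  set T := {z : ℂ | 0 < z.im ∧ 0 < z.re ∧ z.re < 1 / 2 ∧ 1 < Complex.normSq z} with hT
  have hTm : MeasurableSet T := isOpen_tileC.measurableSet
  have hd : ∀ z ∈ T, HasFDerivWithinAt (kleinJ ∘ ofComplex)
      ((ContinuousLinearMap.smulRight (1 : ℂ →L[ℂ] ℂ) (deriv (kleinJ ∘ ofComplex) z)).restrictScalars ℝ)
      T z := fun z hz =>
    ((differentiableOn_kleinJ.differentiableAt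
      ((isOpen_lt continuous_const Complex.continuous_im).mem_nhds hz.1)).hasDerivAt.hasFDerivAt.restrictScalars ℝ)
      |>.hasFDerivWithinAt
  rw [← image_kleinJ_tileC, integrableOn_image_iff_integrableOn_abs_det_fderiv_smul volume hTm hd
    injOn_kleinJ_tileC]
  refine (integrableOn_jacobian_tileC hφ).congr_fun (fun z hz => ?_) hTm
  simp only
  rw [abs_det_restrictScalars_smulRight, deriv_djQuot_tileInv_kleinJ hψ hφ.mdifferentiable hz]

/-- **Absolute integrability of `G'` on the open lower half plane**, in the coordinates `w = (re u, im u)`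
of the KZ calculus (the hypothesis `hGint` of `cauchy_three_edges_re`). [folklore] -/
theorem integrableOn_deriv_djQuot_tileInv
    (hψ : ∀ u : ℂ, u.im ≤ 0 → ψ u ∈ {z : ℍ | z ∈ 𝒟 ∧ 0 ≤ z.re} ∧ kleinJ (ψ u) = u)
    (hφ : IsCuspFunction h φ) :
    IntegrableOn (fun w : Fin 2 → ℝ => deriv (fun u => djQuot φ (ψ u)) ((w 0 : ℂ) + (w 1 : ℂ) * Complex.I))
      {w | w 1 < 0} := by
  have hC := integrableOn_deriv_djQuot_tileInv_complex hψ hφ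
  have hmp : MeasurePreserving Complex.measurableEquivPi.symm volume volume :=
    Complex.volume_preserving_equiv_pi.symm _
  have h2 := (hmp.integrableOn_comp_preimage Complex.measurableEquivPi.symm.measurableEmbedding).mpr hC
  have hpre : Complex.measurableEquivPi.symm ⁻¹' {u : ℂ | u.im < 0} = {w : Fin 2 → ℝ | w 1 < 0} := by
    ext w
    simp [Complex.measurableEquivPi_symm_apply]
  rw [hpre] at h2
  refine h2.congr_fun (fun w _ => ?_) (measurableSet_lt (measurable_pi_apply 1) measurable_const)
  simp [Complex.measurableEquivPi_symm_apply]

end Jacobian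


end Summit.KontsevichZagierPeriods.HeckeMultiplicityOne.ManinStokes
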